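import Summits.QuantumFields.YangMills.Theorems.AllWindowsColdBoxDirFreeVarOctantEnergy
import HarnessLib

/-!
# Stub C `DirFreeVarLinear` (stmt-QuantumFields-24003) — part 3: collar plaquettes, temporal columns, the octant-flow chain

Stub C of LINE-17 (`DirFreeVarLinear`, stmt-QuantumFields-24003) — part 3: the per-edge 2-chains and their Thomson bounds.

For a free edge `e` of the temporal-gauge Dirichlet problem of the cold-wall box `{0,…,2H}⁴` (all box edges off the interior temporal forest):
* bookkeeping: `free_mem`, `free_box`, `free_not_forest`, `free_eq_iff`, `not_free_of_fst/snd`;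
* CLASS 1 `inv_diag_le_one_of_plaquette` (+ `coeffAux_slot1…4`): one collar plaquette whose only free edge is `e` ⇒ `(Q⁻¹)_{ee} ≤ 1`
  (bottom-face spatial edges, edges with a transverse coordinate on a face, temporal edges over a face point);
* CLASS 2 `inv_diag_le_of_column` (`colW`): the upward temporal column over a spatial edge at height `t ≥ 1`, doubled through the face when
  the edge touches `x_i ∈ {0, 2H}` ⇒ `(Q⁻¹)_{ee} ≤ 2(2H+1)`;
* CLASS 3 `inv_diag_le_of_flow`: the time-constant Pólya octant flow of parts 2a/2b for the bottom temporal («Polyakov») edges over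
  spatially interior points ⇒ `(Q⁻¹)_{ee} ≤ 4(2H+2)`.
The case analysis over all free edges and the registered stub are part 4 (`…DirFreeVarLinear`).

HONEST LABEL: helpers for ONE registered stub (C `DirFreeVarLinear`) of two critic-PASSed lines on the R2ξ″ RECORD-rung cruxes
24003/24006; no crux, rung or summit is proved; the Yang–Mills mass gap is NOT proved by this file.
-/

set_option autoImplicit false

noncomputable section

open MeasureTheory Matrix Finset
open Literature.MathematicalPhysics.QuantumFieldTheory
open Literature.MathematicalPhysics.QuantumFieldTheory.LatticeMaxwell
open Literature.MathematicalPhysics.QuantumFieldTheory.AxialGauge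
open Literature.Probability.LatticeModels (Site halfOpenBox mem_halfOpenBox)
open Summit.QuantumFields.YangMills.Theorems.WeakCouplingRates

namespace Summit.QuantumFields.YangMills.Theorems.AllWindowsColdBoxDirFreeVar

/-! ## 6. The per-edge chains and the bound `(Q_D⁻¹)_{ee} ≤ 16 H` -/

section Chains

variable {H : ℕ}

/-! ### Free edges: bookkeeping -/

/-- A free variable is an edge of `dirFreeEdges H`. -/
theorem free_mem (e : DirFree H) : e.1.1 ∈ dirFreeEdges H := not_not.1 e.2

/-- Coordinates of a free edge: base point in the cold box `{0,…,2H}⁴`, far endpoint too. -/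
theorem free_box (e : DirFree H) : (∀ k : Fin 4, 0 ≤ e.1.1.1 k ∧ e.1.1.1 k ≤ 2 * (H : ℤ)) ∧ e.1.1.1 e.1.1.2 + 1 ≤ 2 * (H : ℤ) := by
  have h := (mem_dirFreeEdges.1 (free_mem e)).1
  rw [mem_boxEdges, mem_halfOpenBox, mem_halfOpenBox] at h
  refine ⟨fun k => ?_, ?_⟩
  · have := h.1 k; push_cast at this; omega
  · have := h.2 e.1.1.2
    simp only [Pi.add_apply, Pi.single_eq_same] at this
    push_cast at this; omega

/-- A free edge is not on the temporal forest. -/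
theorem free_not_forest (e : DirFree H) : ¬ (e.1.1.2 = 0 ∧ ∀ k : Fin 4, 1 ≤ e.1.1.1 k ∧ e.1.1.1 k + 1 ≤ 2 * (H : ℤ)) :=
  (mem_dirFreeEdges.1 (free_mem e)).2

/-- Two free variables are equal iff their edges are. -/
theorem free_eq_iff (e e' : DirFree H) : e' = e ↔ e'.1.1 = e.1.1 := by
  constructor
  · rintro rfl; rfl
  · intro h; exact Subtype.ext (Subtype.ext h)

/-- An edge whose base point leaves the cold box is not free. -/
theorem not_free_of_fst {x : Site 4} {i : Fin 4} (hx : ∃ k, x k < 0 ∨ 2 * (H : ℤ) < x k) : (x, i) ∉ dirFreeEdges H :=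
  fun h => not_mem_boxEdges_of_fst hx (mem_dirFreeEdges.1 h).1

/-- An edge whose far endpoint leaves the cold box is not free. -/
theorem not_free_of_snd {x : Site 4} {i : Fin 4}
    (hx : ∃ k : Fin 4, (x + Pi.single i (1 : ℤ) : Site 4) k < 0 ∨ 2 * (H : ℤ) < (x + Pi.single i (1 : ℤ) : Site 4) k) :
    (x, i) ∉ dirFreeEdges H :=
  fun h => not_mem_boxEdges_of_snd hx (mem_dirFreeEdges.1 h).1

/-! ### Class 1: single collar plaquettes -/

/-- **One collar plaquette**: if `q₀` lies in the enlarged box and its free boundary is `c·δ_e` with `c = ±1`, then `(Q⁻¹)_{ee} ≤ 1`. -/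
theorem inv_diag_le_one_of_plaquette (e : DirFree H) (q₀ : Plaq 4)
    (hq₀ : Plaq.shift (-dirCorner) q₀ ∈ plaquettesIn (halfOpenBox 4 (2 * H + 3))) (c : ℝ) (hc : c * c = 1)
    (hcoeff : ∀ e' : DirFree H, coeffAux e'.1.1 q₀ = if e' = e then c else 0) :
    (Qmat (fun e => e ∉ dirFreeEdges H) dirCorner (2 * H + 3))⁻¹ e e ≤ 1 := by
  classical
  refine (inv_diag_le_of_chain (posDef_dirQmat H) (fun q => if q = q₀ then c else 0) e fun e' => ?_).trans ?_
  · rw [chainCoeff_single q₀ hq₀ c e', hcoeff e']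
    split_ifs <;> simp [hc]
  · rw [Finset.sum_eq_single (Plaq.shift (-dirCorner) q₀)]
    · rw [shift_shift_neg, if_pos rfl]; nlinarith
    · intro p _ hp
      rw [if_neg, zero_pow two_ne_zero]
      intro h; apply hp; rw [← h, shift_neg_shift]
    · intro h; exact absurd hq₀ h

/-- Slot 1: `e` is the first edge `(x, i)` of `q₀ = (x,i,j)` and the other three edges are not free ⇒ boundary `+δ_e`. -/
theorem coeffAux_slot1 (q₀ : Plaq 4) (e : DirFree H) (h1 : (q₀.1, q₀.2.1) = e.1.1)
    (h2 : (q₀.1 + Pi.single q₀.2.1 1, q₀.2.2) ∉ dirFreeEdges H) (h3 : (q₀.1 + Pi.single q₀.2.2 1, q₀.2.1) ∉ dirFreeEdges H)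
    (h4 : (q₀.1, q₀.2.2) ∉ dirFreeEdges H) (e' : DirFree H) : coeffAux e'.1.1 q₀ = if e' = e then 1 else 0 := by
  have hf := free_mem e'
  have nh2 : ¬ (e'.1.1 = (q₀.1 + Pi.single q₀.2.1 1, q₀.2.2)) := fun h => h2 (by rw [← h]; exact hf)
  have nh3 : ¬ (e'.1.1 = (q₀.1 + Pi.single q₀.2.2 1, q₀.2.1)) := fun h => h3 (by rw [← h]; exact hf)
  have nh4 : ¬ (e'.1.1 = (q₀.1, q₀.2.2)) := fun h => h4 (by rw [← h]; exact hf)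
  have em : (e'.1.1 = (q₀.1, q₀.2.1)) ↔ e' = e := by rw [free_eq_iff, h1]
  unfold coeffAux
  rw [if_neg nh2, if_neg nh3, if_neg nh4]
  by_cases hp : e' = e
  · rw [if_pos (em.2 hp), if_pos hp]; ring
  · rw [if_neg (fun h => hp (em.1 h)), if_neg hp]; ring

/-- Slot 2: `e` is the second edge `(x + e_i, j)` of `q₀ = (x,i,j)` ⇒ boundary `+δ_e`. -/
theorem coeffAux_slot2 (q₀ : Plaq 4) (e : DirFree H) (h2 : (q₀.1 + Pi.single q₀.2.1 1, q₀.2.2) = e.1.1)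
    (h1 : (q₀.1, q₀.2.1) ∉ dirFreeEdges H) (h3 : (q₀.1 + Pi.single q₀.2.2 1, q₀.2.1) ∉ dirFreeEdges H)
    (h4 : (q₀.1, q₀.2.2) ∉ dirFreeEdges H) (e' : DirFree H) : coeffAux e'.1.1 q₀ = if e' = e then 1 else 0 := by
  have hf := free_mem e'
  have nh1 : ¬ (e'.1.1 = (q₀.1, q₀.2.1)) := fun h => h1 (by rw [← h]; exact hf)
  have nh3 : ¬ (e'.1.1 = (q₀.1 + Pi.single q₀.2.2 1, q₀.2.1)) := fun h => h3 (by rw [← h]; exact hf)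
  have nh4 : ¬ (e'.1.1 = (q₀.1, q₀.2.2)) := fun h => h4 (by rw [← h]; exact hf)
  have em : (e'.1.1 = (q₀.1 + Pi.single q₀.2.1 1, q₀.2.2)) ↔ e' = e := by rw [free_eq_iff, h2]
  unfold coeffAux
  rw [if_neg nh1, if_neg nh3, if_neg nh4]
  by_cases hp : e' = e
  · rw [if_pos (em.2 hp), if_pos hp]; ring
  · rw [if_neg (fun h => hp (em.1 h)), if_neg hp]; ring

/-- Slot 3: `e` is the third edge `(x + e_j, i)` of `q₀ = (x,i,j)` ⇒ boundary `−δ_e`. -/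
theorem coeffAux_slot3 (q₀ : Plaq 4) (e : DirFree H) (h3 : (q₀.1 + Pi.single q₀.2.2 1, q₀.2.1) = e.1.1)
    (h1 : (q₀.1, q₀.2.1) ∉ dirFreeEdges H) (h2 : (q₀.1 + Pi.single q₀.2.1 1, q₀.2.2) ∉ dirFreeEdges H)
    (h4 : (q₀.1, q₀.2.2) ∉ dirFreeEdges H) (e' : DirFree H) : coeffAux e'.1.1 q₀ = if e' = e then -1 else 0 := by
  have hf := free_mem e'
  have nh1 : ¬ (e'.1.1 = (q₀.1, q₀.2.1)) := fun h => h1 (by rw [← h]; exact hf)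
  have nh2 : ¬ (e'.1.1 = (q₀.1 + Pi.single q₀.2.1 1, q₀.2.2)) := fun h => h2 (by rw [← h]; exact hf)
  have nh4 : ¬ (e'.1.1 = (q₀.1, q₀.2.2)) := fun h => h4 (by rw [← h]; exact hf)
  have em : (e'.1.1 = (q₀.1 + Pi.single q₀.2.2 1, q₀.2.1)) ↔ e' = e := by rw [free_eq_iff, h3]
  unfold coeffAux
  rw [if_neg nh1, if_neg nh2, if_neg nh4]
  by_cases hp : e' = e
  · rw [if_pos (em.2 hp), if_pos hp]; ring
  · rw [if_neg (fun h => hp (em.1 h)), if_neg hp]; ring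

/-- Slot 4: `e` is the fourth edge `(x, j)` of `q₀ = (x,i,j)` ⇒ boundary `−δ_e`. -/
theorem coeffAux_slot4 (q₀ : Plaq 4) (e : DirFree H) (h4 : (q₀.1, q₀.2.2) = e.1.1)
    (h1 : (q₀.1, q₀.2.1) ∉ dirFreeEdges H) (h2 : (q₀.1 + Pi.single q₀.2.1 1, q₀.2.2) ∉ dirFreeEdges H)
    (h3 : (q₀.1 + Pi.single q₀.2.2 1, q₀.2.1) ∉ dirFreeEdges H) (e' : DirFree H) : coeffAux e'.1.1 q₀ = if e' = e then -1 else 0 := by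
  have hf := free_mem e'
  have nh1 : ¬ (e'.1.1 = (q₀.1, q₀.2.1)) := fun h => h1 (by rw [← h]; exact hf)
  have nh2 : ¬ (e'.1.1 = (q₀.1 + Pi.single q₀.2.1 1, q₀.2.2)) := fun h => h2 (by rw [← h]; exact hf)
  have nh3 : ¬ (e'.1.1 = (q₀.1 + Pi.single q₀.2.2 1, q₀.2.1)) := fun h => h3 (by rw [← h]; exact hf)
  have em : (e'.1.1 = (q₀.1, q₀.2.2)) ↔ e' = e := by rw [free_eq_iff, h4]
  unfold coeffAux
  rw [if_neg nh1, if_neg nh2, if_neg nh3]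
  by_cases hp : e' = e
  · rw [if_pos (em.2 hp), if_pos hp]; ring
  · rw [if_neg (fun h => hp (em.1 h)), if_neg hp]; ring

/-! ### Class 2: temporal columns -/

/-- The temporal column weights: `−1` on the temporal plaquettes `(x, 0, i₀)` with `t ≤ x₀ ≤ 2H` whose spatial projection is that of
`y` or of `y₂`. -/
def colW (H : ℕ) (t : ℤ) (i₀ : Fin 4) (y y₂ x : Site 4) (k : Fin 4) : ℝ :=
  if k = i₀ ∧ (t ≤ x 0 ∧ x 0 ≤ 2 * (H : ℤ)) ∧
      (Function.update x 0 0 = Function.update y 0 0 ∨ Function.update x 0 0 = Function.update y₂ 0 0) then -1 else 0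

/-- **Temporal column chain** for a spatial edge `e = (y, i₀)` at height `t = y₀ ≥ 1`: if (hΔ) on every free temporal edge `(z, e₀)`
with `z₀ ≥ t` membership of the spatial projection in `{ȳ, ȳ₂}` is invariant under `z ↦ z − e_{i₀}`, and (huniq) `e` is the only free
`i₀`-edge at height `t` over `{ȳ, ȳ₂}`, then `(Q⁻¹)_{ee} ≤ 2(2H+1)`. -/
theorem inv_diag_le_of_column (e : DirFree H) (i₀ : Fin 4) (hi₀ : i₀ ≠ 0) (he : e.1.1.2 = i₀)
    (t : ℤ) (ht : e.1.1.1 0 = t) (ht1 : 1 ≤ t) (y₂ : Site 4)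
    (hy₂ : ∀ j : Fin 4, j ≠ 0 → -1 ≤ y₂ j ∧ y₂ j + (if j = i₀ then 1 else 0) ≤ 2 * (H : ℤ) + 1)
    (hΔ : ∀ z : Site 4, (z, (0 : Fin 4)) ∈ dirFreeEdges H → t ≤ z 0 →
      ((Function.update z 0 0 = Function.update e.1.1.1 0 0 ∨ Function.update z 0 0 = Function.update y₂ 0 0) ↔
       (Function.update (z - Pi.single i₀ 1) 0 0 = Function.update e.1.1.1 0 0 ∨
        Function.update (z - Pi.single i₀ 1) 0 0 = Function.update y₂ 0 0)))
    (huniq : ∀ z : Site 4, (z, i₀) ∈ dirFreeEdges H → z 0 = t →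
      (Function.update z 0 0 = Function.update e.1.1.1 0 0 ∨ Function.update z 0 0 = Function.update y₂ 0 0) → z = e.1.1.1) :
    (Qmat (fun e => e ∉ dirFreeEdges H) dirCorner (2 * H + 3))⁻¹ e e ≤ 2 * (2 * (H : ℝ) + 1) := by
  classical
  have hbox := free_box e
  set y : Site 4 := e.1.1.1 with hy
  set w : Site 4 → Fin 4 → ℝ := colW H t i₀ y y₂ with hw
  have hw0 : ∀ x, w x 0 = 0 := fun x => by simp [hw, colW, Ne.symm hi₀]
  have hwsupp : ∀ x k, w x k ≠ 0 → Plaq.shift (-dirCorner) (x, 0, k) ∈ plaquettesIn (halfOpenBox 4 (2 * H + 3)) := by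
    intro x k h
    simp only [hw, colW, ne_eq, ite_eq_right_iff, neg_eq_zero, one_ne_zero, imp_false, not_not] at h
    obtain ⟨hk, htx, hY⟩ := h
    rw [hk]
    refine shift_mem_index (Fin.pos_iff_ne_zero.2 hi₀) fun l => ?_
    by_cases hl : l = 0
    · subst hl; simp [Ne.symm hi₀]; omega
    · have hxl : x l = y l ∨ x l = y₂ l := by
        rcases hY with h | h
        · left; have := congrFun h l; simpa [Function.update_of_ne hl] using this
        · right; have := congrFun h l; simpa [Function.update_of_ne hl] using this
      have hyl := hbox.1 l
      have hy2l := hy₂ l hl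
      simp only [hl, if_false, add_zero]
      have hyi : y i₀ + 1 ≤ 2 * (H : ℤ) := he ▸ hbox.2
      rcases hxl with h | h <;> rw [h] <;> split_ifs with hli <;> (try subst hli) <;> omega
  refine (inv_diag_le_of_chain (posDef_dirQmat H) (fun q => if q.2.1 = 0 then w q.1 q.2.2 else 0) e fun e' => ?_).trans ?_
  · rw [chainCoeff_temporal w hw0 hwsupp e']
    have hbox' := free_box e'
    obtain ⟨⟨⟨z, i⟩, hmem⟩, hfree⟩ := e'
    have hf : (z, i) ∈ dirFreeEdges H := free_mem ⟨⟨(z, i), hmem⟩, hfree⟩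
    simp only at hbox' ⊢
    have hz0b := hbox'.1 0
    by_cases hi : i = 0
    · -- temporal edge: the column is divergence-free there
      subst hi
      have hne : ¬ ((⟨⟨(z, 0), hmem⟩, hfree⟩ : DirFree H) = e) := fun h => hi₀ (by
        have := congrArg (fun e : DirFree H => e.1.1.2) h; simp only at this; rw [← he, ← this])
      rw [if_pos rfl, if_neg hne]
      rw [Finset.sum_eq_single i₀]
      · have e1 : (z - Pi.single i₀ 1 : Site 4) 0 = z 0 := by simp [Pi.sub_apply, Ne.symm hi₀]
        have hval1 : w z i₀ = if i₀ = i₀ ∧ (t ≤ z 0 ∧ z 0 ≤ 2 * (H : ℤ)) ∧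
            (Function.update z 0 0 = Function.update y 0 0 ∨ Function.update z 0 0 = Function.update y₂ 0 0)
            then -1 else 0 := by rw [hw]; unfold colW; rfl
        have hval2 : w (z - Pi.single i₀ 1) i₀ = if i₀ = i₀ ∧ (t ≤ z 0 ∧ z 0 ≤ 2 * (H : ℤ)) ∧
            (Function.update (z - Pi.single i₀ 1) 0 0 = Function.update y 0 0 ∨
              Function.update (z - Pi.single i₀ 1) 0 0 = Function.update y₂ 0 0) then -1 else 0 := by
          rw [hw]; unfold colW; rw [e1]
        rw [hval1, hval2]
        by_cases htz : t ≤ z 0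
        · by_cases hS : Function.update z 0 0 = Function.update y 0 0 ∨ Function.update z 0 0 = Function.update y₂ 0 0
          · rw [if_pos ⟨rfl, ⟨htz, hz0b.2⟩, hS⟩, if_pos ⟨rfl, ⟨htz, hz0b.2⟩, (hΔ z hf htz).1 hS⟩]; ring
          · rw [if_neg (fun h => hS h.2.2), if_neg (fun h => hS ((hΔ z hf htz).2 h.2.2))]; ring
        · rw [if_neg (fun h => htz h.2.1.1), if_neg (fun h => htz h.2.1.1)]; ring
      · intro k _ hk
        rw [hw]; unfold colW
        rw [if_neg (fun h => hk h.1), if_neg (fun h => hk h.1)]; ring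
      · intro h; exact absurd (Finset.mem_univ _) h
    · -- spatial edge
      rw [if_neg hi]
      have e0 : (z - Pi.single 0 1 : Site 4) 0 = z 0 - 1 := by simp
      have esp : Function.update (z - Pi.single (0 : Fin 4) 1) 0 0 = Function.update z 0 0 := by
        funext j; by_cases hj : j = 0
        · subst hj; simp
        · simp [hj]
      have hval1 : w (z - Pi.single 0 1) i = if i = i₀ ∧ (t ≤ z 0 - 1 ∧ z 0 - 1 ≤ 2 * (H : ℤ)) ∧
          (Function.update z 0 0 = Function.update y 0 0 ∨ Function.update z 0 0 = Function.update y₂ 0 0) then -1 else 0 := by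
        rw [hw]; unfold colW; rw [e0, esp]
      have hval2 : w z i = if i = i₀ ∧ (t ≤ z 0 ∧ z 0 ≤ 2 * (H : ℤ)) ∧
          (Function.update z 0 0 = Function.update y 0 0 ∨ Function.update z 0 0 = Function.update y₂ 0 0) then -1 else 0 := by
        rw [hw]; unfold colW; rfl
      rw [hval1, hval2]
      by_cases hY : i = i₀ ∧ (Function.update z 0 0 = Function.update y 0 0 ∨ Function.update z 0 0 = Function.update y₂ 0 0)
      · obtain ⟨hii, hY⟩ := hY
        by_cases hzt : z 0 = t
        · -- the edge `e` itself
          have hz : z = y := huniq z (hii ▸ hf) hzt hY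
          have heq : (⟨⟨(z, i), hmem⟩, hfree⟩ : DirFree H) = e := (free_eq_iff _ _).2 (Prod.ext hz (hii.trans he.symm))
          rw [if_neg (fun h => by have := h.2.1.1; omega), if_pos ⟨hii, ⟨by omega, by omega⟩, hY⟩, if_pos heq]; ring
        · have hne : ¬ ((⟨⟨(z, i), hmem⟩, hfree⟩ : DirFree H) = e) := by
            intro h; apply hzt
            have := congrArg (fun e : DirFree H => e.1.1.1 0) h
            simp only at this
            rw [this]; exact ht
          rw [if_neg hne]
          by_cases h1 : t ≤ z 0 - 1
          · rw [if_pos ⟨hii, ⟨h1, by omega⟩, hY⟩, if_pos ⟨hii, ⟨by omega, hz0b.2⟩, hY⟩]; ring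
          · rw [if_neg (fun h => h1 h.2.1.1), if_neg (fun h => by have := h.2.1.1; omega)]; ring
      · have hne : ¬ ((⟨⟨(z, i), hmem⟩, hfree⟩ : DirFree H) = e) := by
          intro h; apply hY
          have h' := (free_eq_iff _ _).1 h
          have hz : z = y := congrArg Prod.fst h'
          have hi' : i = e.1.1.2 := congrArg Prod.snd h'
          exact ⟨hi'.trans he, Or.inl (by rw [hz])⟩
        rw [if_neg hne, if_neg (fun h => hY ⟨h.1, h.2.2⟩), if_neg (fun h => hY ⟨h.1, h.2.2⟩)]; ring
  · -- energy: at most two columns of height ≤ 2H+1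
    set U : Finset (ℤ × Site 4) := (Finset.Icc t (2 * (H : ℤ))) ×ˢ ({Function.update y 0 0, Function.update y₂ 0 0} : Finset (Site 4))
      with hU
    set ι : ℤ × Site 4 → Plaq 4 := fun u => (Function.update u.2 0 u.1, 0, i₀) with hι
    have hinj : Set.InjOn ι U := by
      intro u hu u' hu' h
      simp only [hι, Prod.mk.injEq, and_true] at h
      have hu2 : u.2 0 = 0 := by
        rcases Finset.mem_insert.1 (Finset.mem_product.1 hu).2 with h2 | h2
        · rw [h2]; simp
        · rw [Finset.mem_singleton.1 h2]; simp
      have hu2' : u'.2 0 = 0 := by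
        rcases Finset.mem_insert.1 (Finset.mem_product.1 hu').2 with h2 | h2
        · rw [h2]; simp
        · rw [Finset.mem_singleton.1 h2]; simp
      have h0 := congrFun h 0
      simp at h0
      refine Prod.ext h0 (funext fun j => ?_)
      by_cases hj : j = 0
      · subst hj; rw [hu2, hu2']
      · have := congrFun h j; simpa [Function.update_of_ne hj] using this
    have hle := sum_index_le_sum_param (H := H) U ι hinj (fun q => (if q.2.1 = 0 then w q.1 q.2.2 else 0) ^ 2)
      (fun q => sq_nonneg _) (by
        intro q hq
        obtain ⟨x, j, k⟩ := q
        simp only [ne_eq, pow_eq_zero_iff two_ne_zero] at hq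
        split_ifs at hq with hj
        · subst hj
          simp only [hw, colW, ite_eq_right_iff, neg_eq_zero, one_ne_zero, imp_false, not_not] at hq
          obtain ⟨hk, htx, hY⟩ := hq
          rw [hk]
          refine ⟨(x 0, Function.update x 0 0), ?_, ?_⟩
          · simp only [hU, Finset.mem_product, Finset.mem_Icc, Finset.mem_insert, Finset.mem_singleton]
            exact ⟨htx, hY⟩
          · simp only [hι]
            refine Prod.ext ?_ rfl
            simp
        · exact absurd rfl hq)
    refine hle.trans ?_
    calc ∑ u ∈ U, (fun q : Plaq 4 => (if q.2.1 = 0 then w q.1 q.2.2 else 0) ^ 2) (ι u)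
        ≤ ∑ u ∈ U, (1 : ℝ) := Finset.sum_le_sum fun u _ => by
          simp only [hι, hw, colW]
          split_ifs <;> norm_num
      _ = (U.card : ℝ) := by simp
      _ ≤ 2 * (2 * (H : ℝ) + 1) := by
          have h1 : (Finset.Icc t (2 * (H : ℤ))).card ≤ 2 * H + 1 := by
            rw [Int.card_Icc]; omega
          have h2 : ({Function.update y 0 0, Function.update y₂ 0 0} : Finset (Site 4)).card ≤ 2 := Finset.card_le_two
          have : U.card ≤ (2 * H + 1) * 2 := by
            rw [hU, Finset.card_product]; exact Nat.mul_le_mul h1 h2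
          have : (U.card : ℝ) ≤ ((2 * H + 1) * 2 : ℕ) := by exact_mod_cast this
          push_cast at this; linarith

/-! ### Class 3: the bottom temporal «Polyakov» edges -/

/-- **The octant-flow chain**: for a bottom temporal edge `e = ((0, z⃗₀), e₀)` with `z⃗₀` spatially interior,
`(Q⁻¹)_{ee} ≤ 4(2H+2)`. -/
theorem inv_diag_le_of_flow (e : DirFree H) (he : e.1.1.2 = 0) (h0 : e.1.1.1 0 = 0)
    (hint : ∀ j : Fin 4, j ≠ 0 → 1 ≤ e.1.1.1 j ∧ e.1.1.1 j + 1 ≤ 2 * (H : ℤ)) :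
    (Qmat (fun e => e ∉ dirFreeEdges H) dirCorner (2 * H + 3))⁻¹ e e ≤ 4 * (2 * (H : ℝ) + 2) := by
  classical
  set z₀ : Site 4 := e.1.1.1 with hz₀
  have hz₀nn : ∀ j : Fin 4, j ≠ 0 → 0 ≤ z₀ j := fun j hj => by have := (hint j hj).1; omega
  refine (inv_diag_le_of_chain (posDef_dirQmat H) (fun q => if q.2.1 = 0 then octW H z₀ q.1 q.2.2 else 0) e fun e' => ?_).trans
    (octW_energy_le z₀ hz₀nn)
  rw [chainCoeff_temporal (octW H z₀) (octW_zero z₀) (fun x k h => octW_support z₀ hz₀nn x k h) e']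
  have hbox' := free_box e'
  have hnf' := free_not_forest e'
  obtain ⟨⟨⟨z, i⟩, hmem⟩, hfree⟩ := e'
  simp only at hbox' hnf' ⊢
  by_cases hi : i = 0
  · subst hi
    rw [if_pos rfl, octW_div z₀ z ⟨by have := (hbox'.1 0).1; omega, (hbox'.1 0).2⟩ (fun j _ => hbox'.1 j)]
    refine if_congr ⟨fun hsp => ?_, fun h => ?_⟩ rfl rfl
    · -- spatial coordinates agree ⇒ `z₀ = 0` by freeness ⇒ `e' = e`
      have hz0 : z 0 = 0 := by
        by_contra hne
        apply hnf'
        refine ⟨rfl, fun k => ?_⟩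
        by_cases hk : k = 0
        · subst hk; have := hbox'.1 0; have := hbox'.2; omega
        · rw [hsp k hk]; exact hint k hk
      rw [free_eq_iff]
      simp only
      refine Prod.ext (funext fun j => ?_) (by rw [he])
      by_cases hj : j = 0
      · subst hj; show z 0 = z₀ 0; rw [hz0, h0]
      · exact hsp j hj
    · intro j _
      have := (free_eq_iff _ _).1 h
      simp only at this
      rw [show z = z₀ from congrArg Prod.fst this]
  · rw [if_neg hi, octW_sub_e0 z₀ z (hbox'.1 0) i, sub_self, if_neg]
    intro h
    have := congrArg Prod.snd ((free_eq_iff _ _).1 h)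
    simp only at this
    exact hi (this.trans he)

end Chains

end Summit.QuantumFields.YangMills.Theorems.AllWindowsColdBoxDirFreeVar

end
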